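import Literature.Computability.AlgebraicComplexity.LMR13DualVarieties
import HarnessLib

/-!
# The Hessian quadratic form of an immanant (LMR13 §3.4, input of Lemmas 3.3.2 / 3.4.1 at `π = IM_λ`)

[topic Computability/AlgebraicComplexity]

Source. J. M. Landsberg, L. Manivel, N. Ressayre, *Hypersurfaces with degenerate duals and the
geometric complexity theory program*, Comment. Math. Helv. 88 (2013), §3.4 (p. 479; arXiv:1004.4802v1
`paper:arxiv-1004.4802 p0007.txt:L63–74`): "Substituting these expressions into
`H_{IM_λ,w}(X) = IM_λ(w,…,w,X,X)` yields a polynomial `IM_λ(ζ, w′, μ)` which is quadratic in the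
`ζ_i^j` …".  The polarisation `IM_λ(w,…,w,X,X)` is, up to the factor `2`, the Hessian quadratic form
`Xᵀ · Hess IM_λ(w) · X` of the tree (`hessianMatrix`, `HessianRank.lean`; `immanant`,
`LMR13DualVarieties.lean` §3.4).  This file computes it — the `π`-side input of LMR13 Lemma 3.3.2 /
Lemma 3.4.1 for `π = IM_λ` (the `det`-side input, the singular locus `(H_{det_n,w})_{sing}`, is
`LMR13DetHessianKernel.lean`).  Everything is PROVED; no named fact; theorems only.

* `pderiv_prod_X_perm_row`, `pderiv_pderiv_prod_X_perm_row` — derivatives of the row-indexed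
  permutation monomials `∏ᵢ x_{iσ(i)}` (the column-indexed `det` versions are in
  `MR04HessianExactRank.lean` / `MignonRessayreBound.lean`).
* `pderiv_pderiv_immanant`, `hessianMatrix_immanant_apply` —
  `Hess IM_λ(w)_{(c,d),(a,b)} = Σ_{σ : σa = b, σc = d, a ≠ c} χ_λ(σ) ∏_{i ≠ a,c} w_{iσ(i)}`.
* `dotProduct_hessianMatrix_immanant_mulVec` —
  `Xᵀ Hess IM_λ(w) X = Σ_σ χ_λ(σ) Σ_{a ≠ c} X_{aσ(a)} X_{cσ(c)} ∏_{i ≠ a,c} w_{iσ(i)}` (ordered pairs;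
  = `2 · IM_λ(w,…,w,X,X)`).

## References

* [LandsbergManivelRessayre2013] Landsberg–Manivel–Ressayre, Comment. Math. Helv. 88 (2013), §3.3
  (Lemma 3.3.2) and §3.4 (the computation preceding Lemma 3.4.1), pp. 478–479.
-/

noncomputable section

open MvPolynomial Matrix

namespace Literature.Computability.AlgebraicComplexity

open _root_.Literature.NumberTheory.DiophantineGeometry

section ImmanantHessian

variable {n : ℕ}

/-- `∂/∂x_{ab}` of a row-indexed permutation monomial `∏_{i ∈ S} x_{i σ(i)}`: it is
`∏_{i ∈ S, i ≠ a} x_{i σ(i)}` if `a ∈ S` and `σ a = b`, else `0`.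
[cite: LandsbergManivelRessayre2013, §3.4 (p. 479)] -/
theorem pderiv_prod_X_perm_row (S : Finset (Fin n)) (σ : Equiv.Perm (Fin n)) (a b : Fin n) :
    pderiv (a, b) (∏ i ∈ S, (X (i, σ i) : MvPolynomial (Fin n × Fin n) ℂ)) =
      if a ∈ S ∧ σ a = b then ∏ i ∈ S.erase a, X (i, σ i) else 0 := by
  classical
  rw [pderiv_finset_prod]
  simp only [pderiv_X]
  by_cases h : a ∈ S ∧ σ a = b
  · rw [if_pos h, Finset.sum_eq_single_of_mem a h.1]
    · rw [show ((a, σ a) : Fin n × Fin n) = (a, b) from Prod.ext rfl h.2, Pi.single_eq_same, mul_one]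
    · intro i _ hia
      rw [Pi.single_eq_of_ne (fun h' => hia (congrArg Prod.fst h')), mul_zero]
  · rw [if_neg h]
    refine Finset.sum_eq_zero fun i hi => ?_
    rw [Pi.single_eq_of_ne, mul_zero]
    intro h'
    obtain ⟨h1, h2⟩ := Prod.ext_iff.mp h'
    dsimp only at h1 h2
    subst h1
    exact h ⟨hi, h2⟩

/-- Second partial derivatives of a row-indexed permutation monomial:
`∂_{cd} ∂_{ab} ∏ᵢ x_{iσ(i)} = ∏_{i ≠ a, c} x_{iσ(i)}` if `σ a = b`, `σ c = d`, `c ≠ a`, else `0`.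
[cite: LandsbergManivelRessayre2013, §3.4 (p. 479)] -/
theorem pderiv_pderiv_prod_X_perm_row (σ : Equiv.Perm (Fin n)) (a b c d : Fin n) :
    pderiv (c, d) (pderiv (a, b) (∏ i, (X (i, σ i) : MvPolynomial (Fin n × Fin n) ℂ))) =
      if σ a = b ∧ c ≠ a ∧ σ c = d then ∏ i ∈ (Finset.univ.erase a).erase c, X (i, σ i)
      else 0 := by
  rw [pderiv_prod_X_perm_row]
  by_cases h1 : σ a = b
  · rw [if_pos ⟨Finset.mem_univ a, h1⟩, pderiv_prod_X_perm_row]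
    by_cases h2 : c ≠ a ∧ σ c = d
    · rw [if_pos ⟨Finset.mem_erase.mpr ⟨h2.1, Finset.mem_univ c⟩, h2.2⟩, if_pos ⟨h1, h2⟩]
    · rw [if_neg, if_neg]
      · exact fun h => h2 h.2
      · exact fun h => h2 ⟨(Finset.mem_erase.mp h.1).1, h.2⟩
  · rw [if_neg (fun h => h1 h.2), map_zero, if_neg (fun h => h1 h.1)]

/-- **Second partial derivatives of an immanant**:
`∂_{cd} ∂_{ab} IM_λ = Σ_{σ : σ a = b, σ c = d, a ≠ c} χ_λ(σ) ∏_{i ≠ a,c} x_{iσ(i)}`.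
[cite: LandsbergManivelRessayre2013, §3.4 (p. 479)] -/
theorem pderiv_pderiv_immanant (lam : Nat.Partition n) (a b c d : Fin n) :
    pderiv (c, d) (pderiv (a, b) (immanant lam)) = ∑ σ : Equiv.Perm (Fin n),
      if σ a = b ∧ c ≠ a ∧ σ c = d then
        C (spechtCharacter ℂ lam σ) * ∏ i ∈ (Finset.univ.erase a).erase c, X (i, σ i)
      else 0 := by
  rw [immanant, map_sum, map_sum]
  refine Finset.sum_congr rfl fun σ _ => ?_
  rw [smul_eq_C_mul, pderiv_C_mul, pderiv_C_mul, pderiv_pderiv_prod_X_perm_row]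
  split_ifs <;> simp

/-- **The Hessian matrix of an immanant at a point `w`**, entry by entry:
`Hess IM_λ (w)_{(c,d),(a,b)} = Σ_{σ : σ a = b, σ c = d, a ≠ c} χ_λ(σ) ∏_{i ≠ a,c} w_{iσ(i)}`.
[cite: LandsbergManivelRessayre2013, §3.4 (p. 479)] -/
theorem hessianMatrix_immanant_apply (lam : Nat.Partition n) (w : Fin n × Fin n → ℂ)
    (a b c d : Fin n) :
    hessianMatrix (immanant lam) w (c, d) (a, b) = ∑ σ : Equiv.Perm (Fin n),
      if σ a = b ∧ c ≠ a ∧ σ c = d then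
        spechtCharacter ℂ lam σ * ∏ i ∈ (Finset.univ.erase a).erase c, w (i, σ i)
      else 0 := by
  rw [hessianMatrix_apply, pderiv_pderiv_immanant, map_sum]
  refine Finset.sum_congr rfl fun σ _ => ?_
  split_ifs
  · simp [map_prod]
  · simp

/-- **The Hessian quadratic form of an immanant** ("`H_{IM_λ,w}(X) = IM_λ(w,…,w,X,X)`", the
starting point of the computation of LMR13 §3.4, arXiv `p0007.txt:L63–74`; here as
`Xᵀ · Hess IM_λ(w) · X`, i.e. twice the polarisation, summed over ORDERED pairs `a ≠ c`):
`Xᵀ Hess IM_λ(w) X = Σ_σ χ_λ(σ) Σ_{a ≠ c} X_{aσ(a)} X_{cσ(c)} ∏_{i ≠ a,c} w_{iσ(i)}`.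
[cite: LandsbergManivelRessayre2013, §3.4 (p. 479)] -/
theorem dotProduct_hessianMatrix_immanant_mulVec (lam : Nat.Partition n)
    (w X : Fin n × Fin n → ℂ) :
    X ⬝ᵥ (hessianMatrix (immanant lam) w *ᵥ X) = ∑ σ : Equiv.Perm (Fin n),
      spechtCharacter ℂ lam σ * ∑ a, ∑ c ∈ Finset.univ.erase a,
        X (a, σ a) * X (c, σ c) * ∏ i ∈ (Finset.univ.erase a).erase c, w (i, σ i) := by
  -- expand the double sum over `ι × ι` and exchange with the sum over permutations
  have hexp : X ⬝ᵥ (hessianMatrix (immanant lam) w *ᵥ X) =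
      ∑ p : Fin n × Fin n, ∑ q : Fin n × Fin n, ∑ σ : Equiv.Perm (Fin n),
        X p * ((if σ q.1 = q.2 ∧ p.1 ≠ q.1 ∧ σ p.1 = p.2 then
          spechtCharacter ℂ lam σ * ∏ i ∈ (Finset.univ.erase q.1).erase p.1, w (i, σ i)
          else 0) * X q) := by
    simp only [dotProduct, Matrix.mulVec, Finset.mul_sum]
    refine Finset.sum_congr rfl fun p _ => Finset.sum_congr rfl fun q _ => ?_
    obtain ⟨c, d⟩ := p
    obtain ⟨a, b⟩ := q
    rw [hessianMatrix_immanant_apply, Finset.sum_mul, Finset.mul_sum]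
  rw [hexp, Finset.sum_congr rfl fun p _ => Finset.sum_comm, Finset.sum_comm]
  refine Finset.sum_congr rfl fun σ _ => ?_
  -- for a fixed permutation: the sums over `d = p.2` and `b = q.2` collapse
  have hcol : ∀ c : Fin n, (∑ y, ∑ q : Fin n × Fin n, X (c, y) *
      ((if σ q.1 = q.2 ∧ (c, y).1 ≠ q.1 ∧ σ (c, y).1 = (c, y).2 then
        spechtCharacter ℂ lam σ * ∏ i ∈ (Finset.univ.erase q.1).erase (c, y).1, w (i, σ i)
        else 0) * X q)) =
      ∑ a, if c ≠ a then spechtCharacter ℂ lam σ * (X (a, σ a) * X (c, σ c) *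
        ∏ i ∈ (Finset.univ.erase a).erase c, w (i, σ i)) else 0 := by
    intro c
    rw [Finset.sum_eq_single (σ c) (fun y _ hy => Finset.sum_eq_zero fun q _ => by
        rw [if_neg (fun h => hy h.2.2.symm), zero_mul, mul_zero])
      (fun h => absurd (Finset.mem_univ _) h)]
    rw [Fintype.sum_prod_type]
    refine Finset.sum_congr rfl fun a _ => ?_
    rw [Finset.sum_eq_single (σ a) (fun b _ hb => by
        rw [if_neg (fun h => hb h.1.symm), zero_mul, mul_zero])
      (fun h => absurd (Finset.mem_univ _) h)]
    dsimp only
    by_cases hca : c ≠ a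
    · rw [if_pos ⟨rfl, hca, rfl⟩, if_pos hca]
      ring
    · rw [if_neg (fun h => hca h.2.1), if_neg hca, zero_mul, mul_zero]
  rw [Fintype.sum_prod_type]
  simp_rw [hcol]
  rw [Finset.sum_comm, Finset.mul_sum]
  refine Finset.sum_congr rfl fun a _ => ?_
  rw [Finset.mul_sum, ← Finset.sum_filter, Finset.filter_ne']

end ImmanantHessian

end Literature.Computability.AlgebraicComplexity
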